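import Literature.RepresentationTheory.MoeglinVignerasWaldspurger1987.RankOneTorusTraceExplicit
import HarnessLib

/-!
# The reflection `z ↦ -z` of the rank-one oscillator representation: `-1 ∈ U(J₁)(F_v)`, its Schur scalar, and
# the big-cell word of `-g`

[Weil1964] A. Weil, *Sur certains groupes d'opérateurs unitaires*, Acta Math. 111 (1964): n° 6 p. 151 (the Levi
elements `m(a)`), n° 13 (16) p. 160 (the operators `r(s)` on the big cell).  For the rank `1 × 1` dual pair of the
cell `hodgecm-mathlib` (h413 road, SOCKETS-H413 §3 S6 «G2a»):
* §1 **`negOneTorus`-free bookkeeping of `z₁ = -1 ∈ U(J₁)(F_v)`** — built as `localUnitScalar (-1)`; `z₁² = 1`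
  (`localUnitScalar_negOne_mul_self`), the scalar of `z₁ g` is `-ζ_g` (`rankOne_scalar_negOne_mul`), so its
  coordinates are `(-a, -b)` (`rankOne_re_negOne_mul`, `rankOne_im_negOne_mul`).
* §2 **the conjugate of `ι_v(z₁)` is Weil's `m(-1)`** (`rankOne_conj_iota_negOne`) and **the big-cell word of `-g` is
  `r(m(-1)) r(g)`** (`rankOne_bigCellOp_negOne_mul`): the cells of `-g` are `(γ, -B, δ)` (★ `rankOne_cells`), and
  `r(m(-1))` commutes with `r(n(γ))` (★ `leviOpPi_neg_mul_unipOpPi`).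
* §3 **the Schur scalar of `z₁`** (`rankOne_exists_scalar_negOne`): `ω_{s₁}(z₁) = c · r(m(-1))` with `c² = 1`
  (MVW implementer uniqueness ★ `implementerUniqueUpToScalar_schrodingerSB_pi`, transport ★
  `implements_iff_implements_symplecticConj`, and `z₁² = 1`, `r(m(-1))² = 1`).
These feed the reflection asymmetry `‖tr ω(-z)‖² ‖1+a‖ = ‖tr ω(z)‖² ‖1-a‖` of the finite-level characters (next file)
— the `hasym` input of ★ `TwistedCoinv.finrank_weightSpace_add_eq_one_of_trace_eq_neg`.  THEOREMS ONLY;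
count-neutral; HC_CM is proved only modulo the 7 printed citations until rung 0 closes.

## References
* [Weil1964] A. Weil, Acta Math. 111 (1964) 143–211, n° 6 p. 151, n° 13 (16) p. 160.
* [MoeglinVignerasWaldspurger1987] C. Mœglin, M.-F. Vignéras, J.-L. Waldspurger, LNM 1291 (1987), Chap. 2 II.1 (A).
* [Rangarao1993] R. Ranga Rao, Pacific J. Math. 157 (1993), Lemma 3.2 (1), (3.8) p. 351.
-/

set_option autoImplicit false

noncomputable section

open NumberField IsDedekindDomain Matrix MeasureTheory
open scoped Matrix MatrixGroups NNReal Topology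
open Literature.RepresentationTheory Literature.RepresentationTheory.HeisenbergGroup
open Literature.NumberTheory.GelbartRogawski1991.UnitaryDualPair.LocalSplitting
open Literature.NumberTheory.Automorphic Literature.NumberTheory.Automorphic.UnitaryGroup
open Literature.NumberTheory.Automorphic.Liu2021
open Literature.NumberTheory.GaloisRepresentations.IsNonarchimedeanLocalField
open Literature.NumberTheory.Weil1964

namespace Literature.RepresentationTheory.MoeglinVignerasWaldspurger1987

/-! ## §1 `z₁ = -1 ∈ U(J₁)(F_v)` -/

section NegOne

variable {F : Type} [Field F] [NumberField F] (E : Type) [Field E] [NumberField E] [Algebra F E]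
  (c : E ≃ₐ[F] E) (J₁ : Matrix (Fin 1) (Fin 1) E) (v : HeightOneSpectrum (𝓞 F))

/-- `(-1) · c(-1) = 1` in `E_v`: `-1` is a norm-one scalar. [cite: Weil1964, n° 6, p. 151] -/
theorem negOne_mul_conjLocal_negOne :
    (((-1 : (LocalRing E v)ˣ) : (LocalRing E v)ˣ) : LocalRing E v) * conjLocal E c v ((-1 : (LocalRing E v)ˣ)) = 1 := by
  rw [Units.val_neg, Units.val_one, map_neg, map_one, neg_mul_neg, one_mul]

/-- the `w`-entry of a product in `U(J₁)(F_v)` is the product of the entries (`1 × 1` matrices).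
[cite: Mok2014, §1 Notation p. 5] -/
theorem rankOne_entry_mul (g h : localPi E c 1 J₁ v) (w : PlacesOver E v) :
    ((((g * h : localPi E c 1 J₁ v) : LocalGLPi E 1 v) w : GL (Fin 1) (w.1.adicCompletion E)) :
        Matrix (Fin 1) (Fin 1) (w.1.adicCompletion E)) 0 0 =
      ((((g : localPi E c 1 J₁ v) : LocalGLPi E 1 v) w : GL (Fin 1) (w.1.adicCompletion E)) :
          Matrix (Fin 1) (Fin 1) (w.1.adicCompletion E)) 0 0 *
        ((((h : localPi E c 1 J₁ v) : LocalGLPi E 1 v) w : GL (Fin 1) (w.1.adicCompletion E)) :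
          Matrix (Fin 1) (Fin 1) (w.1.adicCompletion E)) 0 0 := by
  change ((((g : LocalGLPi E 1 v) w * (h : LocalGLPi E 1 v) w : GL (Fin 1) (w.1.adicCompletion E)) :
    Matrix (Fin 1) (Fin 1) (w.1.adicCompletion E)) 0 0) = _
  rw [Units.val_mul, Matrix.mul_apply, Fin.sum_univ_one]

/-- the `w`-entry of `1 ∈ U(J₁)(F_v)` is `1`. [cite: Mok2014, §1 Notation p. 5] -/
theorem rankOne_entry_one (w : PlacesOver E v) :
    ((((1 : localPi E c 1 J₁ v) : LocalGLPi E 1 v) w : GL (Fin 1) (w.1.adicCompletion E)) :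
        Matrix (Fin 1) (Fin 1) (w.1.adicCompletion E)) 0 0 = 1 := by
  change ((((1 : LocalGLPi E 1 v) w : GL (Fin 1) (w.1.adicCompletion E)) :
    Matrix (Fin 1) (Fin 1) (w.1.adicCompletion E)) 0 0) = 1
  rw [Pi.one_apply, Units.val_one, Matrix.one_apply_eq]

/-- two elements of `U(J₁)(F_v)` with the same entries at every `w ∣ v` are equal (`1 × 1` matrices).
[cite: Mok2014, §1 Notation p. 5] -/
theorem rankOne_eq_of_forall_entry_eq {z z' : localPi E c 1 J₁ v}
    (h : ∀ w : PlacesOver E v,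
      (((z : LocalGLPi E 1 v) w : GL (Fin 1) (w.1.adicCompletion E)) : Matrix (Fin 1) (Fin 1) (w.1.adicCompletion E)) 0 0 =
      (((z' : LocalGLPi E 1 v) w : GL (Fin 1) (w.1.adicCompletion E)) : Matrix (Fin 1) (Fin 1) (w.1.adicCompletion E)) 0 0) :
    z = z' := by
  refine Subtype.ext (funext fun w => Units.ext (Matrix.ext fun i j => ?_))
  obtain rfl : i = 0 := Subsingleton.elim _ _
  obtain rfl : j = 0 := Subsingleton.elim _ _
  exact h w

/-- **`z₁² = 1`** for `z₁ = localUnitScalar (-1)`. [cite: Weil1964, n° 6, p. 151] -/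
theorem localUnitScalar_negOne_mul_self :
    localUnitScalar E c J₁ v (-1) (negOne_mul_conjLocal_negOne E c v) *
      localUnitScalar E c J₁ v (-1) (negOne_mul_conjLocal_negOne E c v) = 1 := by
  refine rankOne_eq_of_forall_entry_eq E c J₁ v fun w => ?_
  rw [rankOne_entry_mul, rankOne_entry_one, coe_localUnitScalar_apply, Units.val_neg, Units.val_one, Pi.neg_apply,
    Pi.one_apply, neg_mul_neg, one_mul]

/-- the scalar of `z₁ g` is `-ζ_g`. [cite: Weil1964, n° 6, p. 151] -/
theorem rankOne_scalar_negOne_mul (g : localPi E c 1 J₁ v) :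
    (fun w : PlacesOver E v =>
        (((localUnitScalar E c J₁ v (-1) (negOne_mul_conjLocal_negOne E c v) * g : localPi E c 1 J₁ v) :
          LocalGLPi E 1 v) w).val 0 0 : LocalRing E v) =
      -fun w : PlacesOver E v => ((g : LocalGLPi E 1 v) w).val 0 0 := by
  rw [rankOne_scalar_mul]
  funext w
  rw [Pi.mul_apply, Pi.neg_apply, coe_localUnitScalar_apply, Units.val_neg, Units.val_one, Pi.neg_apply, Pi.one_apply,
    neg_one_mul]

variable [Algebra.IsQuadraticExtension F E] {δ : E} (hcδ : c δ = -δ) (hδ : δ ≠ 0)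

/-- `a(z₁ g) = -a(g)`. [cite: Weil1964, n° 7, p. 152] -/
theorem rankOne_re_negOne_mul (g : localPi E c 1 J₁ v) :
    QuadraticCoordinates.re (quadraticLocalEquiv E v c hcδ hδ).toLinearEquiv.toAddEquiv
        (fun w : PlacesOver E v =>
          (((localUnitScalar E c J₁ v (-1) (negOne_mul_conjLocal_negOne E c v) * g : localPi E c 1 J₁ v) :
            LocalGLPi E 1 v) w).val 0 0) =
      -QuadraticCoordinates.re (quadraticLocalEquiv E v c hcδ hδ).toLinearEquiv.toAddEquiv
        (fun w : PlacesOver E v => ((g : LocalGLPi E 1 v) w).val 0 0) := by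
  rw [rankOne_scalar_negOne_mul, map_neg]

/-- `b(z₁ g) = -b(g)`. [cite: Weil1964, n° 7, p. 152] -/
theorem rankOne_im_negOne_mul (g : localPi E c 1 J₁ v) :
    QuadraticCoordinates.im (quadraticLocalEquiv E v c hcδ hδ).toLinearEquiv.toAddEquiv
        (fun w : PlacesOver E v =>
          (((localUnitScalar E c J₁ v (-1) (negOne_mul_conjLocal_negOne E c v) * g : localPi E c 1 J₁ v) :
            LocalGLPi E 1 v) w).val 0 0) =
      -QuadraticCoordinates.im (quadraticLocalEquiv E v c hcδ hδ).toLinearEquiv.toAddEquiv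
        (fun w : PlacesOver E v => ((g : LocalGLPi E 1 v) w).val 0 0) := by
  rw [rankOne_scalar_negOne_mul, map_neg]

end NegOne

/-! ## §2 The conjugate of `ι_v(z₁)` is `m(-1)`; the big-cell word of `-g` -/

section Word

variable {F : Type} [Field F] [NumberField F] (E : Type) [Field E] [NumberField E] [Algebra F E]
  [Algebra.IsQuadraticExtension F E] (c : E ≃ₐ[F] E) {δ : E} (hcδ : c δ = -δ) (hδ : δ ≠ 0) {d : F}
  (hd : δ * δ = algebraMap F E d) (t : Matrix (Fin 1) (Fin 1) F) (ht : t.IsSymm) (htd : IsUnit t.det)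
  {J₁ : Matrix (Fin 1) (Fin 1) E} (hJ₁ : J₁ = t.map (algebraMap F E)) (v : HeightOneSpectrum (𝓞 F))

/-- **`e ι_v(z₁) e⁻¹ = m(-1)`**: the scalar `-1` of `U(J₁)(F_v)` acts on `F_v × F_v` as `-1`, which is Weil's Levi
element `m(-1) = (-1, ᵗ(-1)⁻¹)`. [cite: Weil1964, n° 6, p. 151] -/
theorem rankOne_conj_iota_negOne :
    symplecticConj (gramProd (localGram F 1 t v) (UnitaryGroup.isUnit_det_map (algebraMap F (v.adicCompletion F)) htd))
        (polar_dotProductBilin_gramProd (localGram F 1 t v) (UnitaryGroup.isUnit_det_map (algebraMap F (v.adicCompletion F)) htd))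
        (iota F E c 1 hcδ hδ hd t ht hJ₁ v (localUnitScalar E c J₁ v (-1) (negOne_mul_conjLocal_negOne E c v))) =
      leviSp (dotProductBilin (v.adicCompletion F) (v.adicCompletion F) (m := Fin 1))
        (LinearEquiv.neg (v.adicCompletion F)) (dualLeviPi (LinearEquiv.neg (v.adicCompletion F)))
        (dotProductBilin_apply_dualLeviPi _) := by
  have hq := isQuadraticCoordinates_local E v c hcδ hδ hd
  have hsc : (fun w : PlacesOver E v =>
      (((localUnitScalar E c J₁ v (-1) (negOne_mul_conjLocal_negOne E c v) : localPi E c 1 J₁ v) :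
        LocalGLPi E 1 v) w).val 0 0 : LocalRing E v) = -1 := by
    funext w
    rw [coe_localUnitScalar_apply, Units.val_neg, Units.val_one]
  have hre : QuadraticCoordinates.re (quadraticLocalEquiv E v c hcδ hδ).toLinearEquiv.toAddEquiv
      (fun w : PlacesOver E v =>
        (((localUnitScalar E c J₁ v (-1) (negOne_mul_conjLocal_negOne E c v) : localPi E c 1 J₁ v) :
          LocalGLPi E 1 v) w).val 0 0) = -1 := by
    rw [hsc, map_neg, hq.re_one]
  have him : QuadraticCoordinates.im (quadraticLocalEquiv E v c hcδ hδ).toLinearEquiv.toAddEquiv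
      (fun w : PlacesOver E v =>
        (((localUnitScalar E c J₁ v (-1) (negOne_mul_conjLocal_negOne E c v) : localPi E c 1 J₁ v) :
          LocalGLPi E 1 v) w).val 0 0) = 0 := by
    rw [hsc, map_neg, hq.im_one, neg_zero]
  apply Subtype.ext; apply LinearEquiv.ext; rintro ⟨x, y⟩
  rw [rankOne_conj_iota_apply E c hcδ hδ hd t ht htd hJ₁ v _ x y, hre, him, coe_leviSp_apply]
  refine Prod.ext (funext fun i => ?_) (funext fun i => ?_)
  · simp only [LinearEquiv.neg_apply, Pi.neg_apply, mul_zero, zero_mul, add_zero, neg_one_mul]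
  · simp only [dualLeviPi_neg, Pi.neg_apply, mul_zero, zero_mul, zero_add, neg_one_mul]

set_option maxHeartbeats 1600000 in -- MEASURED: two big-cell words with their six cells in one context exceed 200 k
/-- **the big-cell word of `-g` is `r(m(-1)) · r(g)`**: for `g ∈ U(J₁)(F_v)` with `g' = e ι_v(g) e⁻¹` in the big
cell, the cells of `(z₁ g)' = -g'` are `(γ, -B, δ)` and `r(n(γ) m(-B) w n(δ)) = r(m(-1)) r(n(γ) m(B) w n(δ))`.
[cite: Weil1964, n° 13 (16), p. 160; Rangarao1993, Lemma 3.2 (1), (3.8) p. 351] -/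
theorem rankOne_bigCellOp_negOne_mul [MeasurableSpace (v.adicCompletion F)] [BorelSpace (v.adicCompletion F)]
    (μ : Measure (v.adicCompletion F)) [μ.IsAddHaarMeasure] (m : ℤ) (hm : (adeleAddCharAt F v).HasConductorExp m)
    (g : localPi E c 1 J₁ v)
    (hβ : (d : v.adicCompletion F) *
        QuadraticCoordinates.im (quadraticLocalEquiv E v c hcδ hδ).toLinearEquiv.toAddEquiv
          (fun w : PlacesOver E v => ((g : LocalGLPi E 1 v) w).val 0 0) * (localGram F 1 t v 0 0)⁻¹ ≠ 0) :
    bigCellOp (isLocallyConstant_of_isContinuousNontrivial (isContinuousNontrivial_adeleAddCharAt F v)) μ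
        (isContinuousNontrivial_adeleAddCharAt F v) hm
        (symplecticConj (gramProd (localGram F 1 t v) (UnitaryGroup.isUnit_det_map (algebraMap F (v.adicCompletion F)) htd))
          (polar_dotProductBilin_gramProd (localGram F 1 t v) (UnitaryGroup.isUnit_det_map (algebraMap F (v.adicCompletion F)) htd))
          (iota F E c 1 hcδ hδ hd t ht hJ₁ v (localUnitScalar E c J₁ v (-1) (negOne_mul_conjLocal_negOne E c v) * g))) =
      leviOpPi (LinearEquiv.neg (v.adicCompletion F) : (Fin 1 → v.adicCompletion F) ≃ₗ[v.adicCompletion F]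
          (Fin 1 → v.adicCompletion F)) *
        bigCellOp (isLocallyConstant_of_isContinuousNontrivial (isContinuousNontrivial_adeleAddCharAt F v)) μ
          (isContinuousNontrivial_adeleAddCharAt F v) hm
          (symplecticConj (gramProd (localGram F 1 t v) (UnitaryGroup.isUnit_det_map (algebraMap F (v.adicCompletion F)) htd))
            (polar_dotProductBilin_gramProd (localGram F 1 t v) (UnitaryGroup.isUnit_det_map (algebraMap F (v.adicCompletion F)) htd))
            (iota F E c 1 hcδ hδ hd t ht hJ₁ v g)) := by
  set z₁ := localUnitScalar E c J₁ v (-1) (negOne_mul_conjLocal_negOne E c v) with hz₁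
  set hl := isLocallyConstant_of_isContinuousNontrivial (isContinuousNontrivial_adeleAddCharAt F v)
  set hψ := isContinuousNontrivial_adeleAddCharAt F v
  set e := gramProd (localGram F 1 t v) (UnitaryGroup.isUnit_det_map (algebraMap F (v.adicCompletion F)) htd) with he
  have hBe := polar_dotProductBilin_gramProd (localGram F 1 t v) (UnitaryGroup.isUnit_det_map (algebraMap F (v.adicCompletion F)) htd)
  set a := QuadraticCoordinates.re (quadraticLocalEquiv E v c hcδ hδ).toLinearEquiv.toAddEquiv
    (fun w : PlacesOver E v => ((g : LocalGLPi E 1 v) w).val 0 0) with ha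
  set b := QuadraticCoordinates.im (quadraticLocalEquiv E v c hcδ hδ).toLinearEquiv.toAddEquiv
    (fun w : PlacesOver E v => ((g : LocalGLPi E 1 v) w).val 0 0) with hb
  have ha' := rankOne_re_negOne_mul E c J₁ v hcδ hδ g
  have hb' := rankOne_im_negOne_mul E c J₁ v hcδ hδ g
  rw [← hz₁] at ha' hb'
  rw [← ha] at ha'; rw [← hb] at hb'
  have hβ' : (d : v.adicCompletion F) *
      QuadraticCoordinates.im (quadraticLocalEquiv E v c hcδ hδ).toLinearEquiv.toAddEquiv
        (fun w : PlacesOver E v => (((z₁ * g : localPi E c 1 J₁ v) : LocalGLPi E 1 v) w).val 0 0) *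
      (localGram F 1 t v 0 0)⁻¹ ≠ 0 := by
    rw [hb', mul_neg, neg_mul, neg_ne_zero]; exact hβ
  set g' := symplecticConj e hBe (iota F E c 1 hcδ hδ hd t ht hJ₁ v g) with hg'
  set g'' := symplecticConj e hBe (iota F E c 1 hcδ hδ hd t ht hJ₁ v (z₁ * g)) with hg''
  have hB := rankOne_blockB_bijective E c hcδ hδ hd t ht htd hJ₁ v g g' hg' hβ
  have hB' := rankOne_blockB_bijective E c hcδ hδ hd t ht htd hJ₁ v (z₁ * g) g'' hg'' hβ'
  have hc := rankOne_cells E c hcδ hδ hd t ht htd hJ₁ v g g' hg' hβ hB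
  have hc' := rankOne_cells E c hcδ hδ hd t ht htd hJ₁ v (z₁ * g) g'' hg'' hβ' hB'
  simp only [ha', hb'] at hc'
  rw [← ha, ← hb] at hc
  -- the cells of `-g'`: `γ'' = γ`, `δ'' = δ`, `B'' = (-1) ∘ B`
  have hγ : cellGamma (g'' : ((Fin 1 → v.adicCompletion F) × (Fin 1 → v.adicCompletion F)) ≃ₗ[v.adicCompletion F]
        ((Fin 1 → v.adicCompletion F) × (Fin 1 → v.adicCompletion F))) hB' =
      cellGamma (g' : ((Fin 1 → v.adicCompletion F) × (Fin 1 → v.adicCompletion F)) ≃ₗ[v.adicCompletion F]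
        ((Fin 1 → v.adicCompletion F) × (Fin 1 → v.adicCompletion F))) hB := by
    apply LinearMap.ext; intro x
    rw [(hc' x).2.1, (hc x).2.1]
    congr 1
    have hd0 : (d : v.adicCompletion F) * b * (localGram F 1 t v 0 0)⁻¹ ≠ 0 := hβ
    field_simp
  have hδc : cellDelta (g'' : ((Fin 1 → v.adicCompletion F) × (Fin 1 → v.adicCompletion F)) ≃ₗ[v.adicCompletion F]
        ((Fin 1 → v.adicCompletion F) × (Fin 1 → v.adicCompletion F))) hB' =
      cellDelta (g' : ((Fin 1 → v.adicCompletion F) × (Fin 1 → v.adicCompletion F)) ≃ₗ[v.adicCompletion F]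
        ((Fin 1 → v.adicCompletion F) × (Fin 1 → v.adicCompletion F))) hB := by
    apply LinearMap.ext; intro x
    rw [(hc' x).2.2, (hc x).2.2]
    congr 1
    have hd0 : (d : v.adicCompletion F) * b * (localGram F 1 t v 0 0)⁻¹ ≠ 0 := hβ
    field_simp
  have hBc : cellB (g'' : ((Fin 1 → v.adicCompletion F) × (Fin 1 → v.adicCompletion F)) ≃ₗ[v.adicCompletion F]
        ((Fin 1 → v.adicCompletion F) × (Fin 1 → v.adicCompletion F))) hB' =
      (LinearEquiv.neg (v.adicCompletion F) : (Fin 1 → v.adicCompletion F) ≃ₗ[v.adicCompletion F]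
          (Fin 1 → v.adicCompletion F)) *
        cellB (g' : ((Fin 1 → v.adicCompletion F) × (Fin 1 → v.adicCompletion F)) ≃ₗ[v.adicCompletion F]
          ((Fin 1 → v.adicCompletion F) × (Fin 1 → v.adicCompletion F))) hB := by
    apply LinearEquiv.ext; intro y
    -- `B'' y = -β y` and `B y = β y`, from the inverse formulas
    have e1 := (hc' (cellB _ hB' y)).1
    have e2 := (hc (cellB _ hB y)).1
    rw [LinearEquiv.symm_apply_apply] at e1 e2
    rw [LinearEquiv.mul_apply, LinearEquiv.neg_apply]
    have hβ0 : (d : v.adicCompletion F) * b * (localGram F 1 t v 0 0)⁻¹ ≠ 0 := hβ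
    have hβ0' : (d : v.adicCompletion F) * -b * (localGram F 1 t v 0 0)⁻¹ ≠ 0 := by
      rw [mul_neg, neg_mul, neg_ne_zero]; exact hβ
    have f1 : cellB _ hB' y = ((d : v.adicCompletion F) * -b * (localGram F 1 t v 0 0)⁻¹) • y := by
      have h1 := congrArg (fun u => ((d : v.adicCompletion F) * -b * (localGram F 1 t v 0 0)⁻¹) • u) e1
      simp only [smul_smul, mul_inv_cancel₀ hβ0', one_smul] at h1
      exact h1.symm
    have f2 : cellB _ hB y = ((d : v.adicCompletion F) * b * (localGram F 1 t v 0 0)⁻¹) • y := by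
      have h2 := congrArg (fun u => ((d : v.adicCompletion F) * b * (localGram F 1 t v 0 0)⁻¹) • u) e2
      simp only [smul_smul, mul_inv_cancel₀ hβ0, one_smul] at h2
      exact h2.symm
    rw [f1, f2, ← neg_smul]
    congr 1
    ring
  rw [bigCellOp_of_bijective hl μ hψ hm g'' hB', bigCellOp_of_bijective hl μ hψ hm g' hB, hγ, hδc, hBc, leviOpPi_mul,
    ← mul_assoc, ← mul_assoc, ← leviOpPi_neg_mul_unipOpPi]
  simp only [mul_assoc]

end Word

/-! ## §3 The Schur scalar of `z₁`: `ω_{s₁}(z₁) = c · r(m(-1))`, `c² = 1` -/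

section Schur

variable (F : Type) [Field F] [NumberField F] (E : Type) [Field E] [NumberField E] [Algebra F E]
  [Algebra.IsQuadraticExtension F E] (c : E ≃ₐ[F] E) (δ : E) (hcδ : c δ = -δ) (hδ : δ ≠ 0) (d : F)
  (hd : δ * δ = algebraMap F E d) (t : Matrix (Fin 1) (Fin 1) F) (ht : t.IsSymm) (htd : IsUnit t.det)
  (J₁ : Matrix (Fin 1) (Fin 1) E) (hJ₁ : J₁ = t.map (algebraMap F E)) (v : HeightOneSpectrum (𝓞 F))
  (s₁ : localPi E c 1 J₁ v →* LocalMp F 1 t v)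
  (hs₁ : ∀ g, MpPsi.proj _ (s₁ g) = iota F E c 1 hcδ hδ hd t ht hJ₁ v g)

omit [NumberField E] [Algebra.IsQuadraticExtension F E] in
/-- `β_{𝕋_v}(·, y)` is continuous. [folklore] -/
private theorem continuous_localPairing_left_negOne (y : Fin 1 → v.adicCompletion F) :
    Continuous fun u : Fin 1 → v.adicCompletion F => Matrix.toLinearMap₂' (v.adicCompletion F) (localGram F 1 t v) u y := by
  simp only [Matrix.toLinearMap₂'_apply', dotProduct]
  exact continuous_finsetSum _ fun i _ => (continuous_apply i).mul continuous_const

set_option maxHeartbeats 800000 in -- MEASURED: the transported implementer statements exceed 200 k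
include htd hs₁ in
/-- **`ω_{s₁}(z₁) = c · r(m(-1))` with `c² = 1`**: both `ω_{s₁}(z₁)` and `r(m(-1)) : Φ ↦ Φ(-·)` implement
`e ι_v(z₁) e⁻¹ = m(-1)` (transport of structure, ★ `levi_leviOpPi_mem_MpPsi`), implementers are unique up to a
scalar `c` (MVW II.1), and `z₁² = 1`, `r(m(-1))² = 1` force `c² = 1`.
[cite: MoeglinVignerasWaldspurger1987, Chap. 2 II.1 (A); Weil1964, n° 13, p. 160] -/
theorem rankOne_exists_scalar_negOne :
    ∃ cneg : ℂ, cneg * cneg = 1 ∧ ∀ f : SchwartzBruhat (Fin 1 → v.adicCompletion F),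
      ((MpPsi.toRep (localSchrodinger F 1 t v)).comp s₁)
          (localUnitScalar E c J₁ v (-1) (negOne_mul_conjLocal_negOne E c v)) f =
        cneg • leviOpPi (LinearEquiv.neg (v.adicCompletion F) : (Fin 1 → v.adicCompletion F) ≃ₗ[v.adicCompletion F]
          (Fin 1 → v.adicCompletion F)) f := by
  set z₁ := localUnitScalar E c J₁ v (-1) (negOne_mul_conjLocal_negOne E c v) with hz₁
  have hψ := isContinuousNontrivial_adeleAddCharAt F v
  have hb : ∀ y : Fin 1 → v.adicCompletion F,
      Continuous fun u : Fin 1 → v.adicCompletion F => dotProductBilin (v.adicCompletion F) (v.adicCompletion F) u y :=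
    continuous_dotProductBilin_left
  have hBe := polar_dotProductBilin_gramProd (localGram F 1 t v) (UnitaryGroup.isUnit_det_map (algebraMap F (v.adicCompletion F)) htd)
  -- (1) `ω_{s₁}(z₁)` implements `ι(z₁)` for the Gram model, hence `m(-1)` for the dot model
  have h1 : Implements (localSchrodinger F 1 t v) (ofSymplectic _ (iota F E c 1 hcδ hδ hd t ht hJ₁ v z₁))
      (MpPsi.toOp _ (s₁ z₁)) := by
    have h := MpPsi.toRep_implements (localSchrodinger F 1 t v) (s₁ z₁)
    have e1 : ((s₁ z₁ : LocalMp F 1 t v) : LocalSp F 1 t v × (SchwartzBruhat (Fin 1 → v.adicCompletion F) ≃ₗ[ℂ]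
        SchwartzBruhat (Fin 1 → v.adicCompletion F))).1 = iota F E c 1 hcδ hδ hd t ht hJ₁ v z₁ := hs₁ z₁
    rw [e1] at h
    exact h
  have hρ : ∀ a, localSchrodinger F 1 t v a =
      schrodingerSB (dotProductBilin (v.adicCompletion F) (v.adicCompletion F) (m := Fin 1)) (adeleAddCharAt F v)
        (isLocallyConstant_of_isContinuousNontrivial hψ) hb
        (Heisenberg.mapEquiv (gramProd (localGram F 1 t v) (UnitaryGroup.isUnit_det_map (algebraMap F (v.adicCompletion F)) htd)) hBe a) := fun a =>
    schrodingerSB_gram_eq (localGram F 1 t v) (UnitaryGroup.isUnit_det_map (algebraMap F (v.adicCompletion F)) htd) (isLocallyConstant_of_isContinuousNontrivial hψ)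
      hb (continuous_localPairing_left_negOne F t v) a
  have h2 := (implements_iff_implements_symplecticConj (gramProd (localGram F 1 t v) (UnitaryGroup.isUnit_det_map (algebraMap F (v.adicCompletion F)) htd)) hBe hρ
    (iota F E c 1 hcδ hδ hd t ht hJ₁ v z₁) (MpPsi.toOp _ (s₁ z₁))).1 h1
  rw [hz₁, rankOne_conj_iota_negOne E c hcδ hδ hd t ht htd hJ₁ v] at h2
  -- (2) `r(m(-1))` implements `m(-1)`
  have h3 : Implements (schrodingerSB (dotProductBilin (v.adicCompletion F) (v.adicCompletion F) (m := Fin 1))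
      (adeleAddCharAt F v) (isLocallyConstant_of_isContinuousNontrivial hψ) hb)
      (ofSymplectic _ (leviSp (dotProductBilin (v.adicCompletion F) (v.adicCompletion F) (m := Fin 1))
        (LinearEquiv.neg (v.adicCompletion F)) (dualLeviPi (LinearEquiv.neg (v.adicCompletion F)))
        (dotProductBilin_apply_dualLeviPi _)))
      (leviOpPi (LinearEquiv.neg (v.adicCompletion F) : (Fin 1 → v.adicCompletion F) ≃ₗ[v.adicCompletion F]
          (Fin 1 → v.adicCompletion F))) := by
    have h := levi_leviOpPi_mem_MpPsi (ψ := adeleAddCharAt F v) (isLocallyConstant_of_isContinuousNontrivial hψ) hb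
      (LinearEquiv.neg (v.adicCompletion F) : (Fin 1 → v.adicCompletion F) ≃ₗ[v.adicCompletion F] (Fin 1 → v.adicCompletion F))
    rwa [mem_MpPsi] at h
  -- (3) uniqueness up to a scalar
  obtain ⟨lam, hlam⟩ :=
    implementerUniqueUpToScalar_schrodingerSB_pi (isLocallyConstant_of_isContinuousNontrivial hψ) hb hψ _ _ _ h3 h2
  have hval : ∀ f : SchwartzBruhat (Fin 1 → v.adicCompletion F),
      ((MpPsi.toRep (localSchrodinger F 1 t v)).comp s₁) z₁ f =
        (lam : ℂ) • leviOpPi (LinearEquiv.neg (v.adicCompletion F) : (Fin 1 → v.adicCompletion F) ≃ₗ[v.adicCompletion F]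
          (Fin 1 → v.adicCompletion F)) f := fun f => hlam f
  refine ⟨lam, ?_, hval⟩
  -- (4) `c² = 1` from `z₁² = 1` and `r(m(-1))² = 1`, tested on the ball `1_{𝒪}`
  set f₀ : SchwartzBruhat (Fin 1 → v.adicCompletion F) := piBallSB (v.adicCompletion F) (Fin 1) 0 with hf₀
  have hsq : ((MpPsi.toRep (localSchrodinger F 1 t v)).comp s₁) z₁
      (((MpPsi.toRep (localSchrodinger F 1 t v)).comp s₁) z₁ f₀) = f₀ := by
    rw [← Module.End.mul_apply, ← map_mul, hz₁, localUnitScalar_negOne_mul_self, map_one, Module.End.one_apply]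
  rw [hval f₀, map_smul, hval, smul_smul, ← LinearEquiv.mul_apply, ← leviOpPi_mul] at hsq
  have hneg : (LinearEquiv.neg (v.adicCompletion F) * LinearEquiv.neg (v.adicCompletion F) :
      (Fin 1 → v.adicCompletion F) ≃ₗ[v.adicCompletion F] (Fin 1 → v.adicCompletion F)) = 1 := by
    apply LinearEquiv.ext; intro x; simp
  rw [hneg, leviOpPi_one, LinearEquiv.coe_one, id_eq] at hsq
  have hf0 : f₀ ≠ 0 := by
    intro h0
    have h2 := congrArg (fun f : SchwartzBruhat (Fin 1 → (v.adicCompletion F)) => (f : (Fin 1 → (v.adicCompletion F)) → ℂ) 0) h0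
    simp only [hf₀, coe_piBallSB, Submodule.coe_zero, Pi.zero_apply,
      Set.indicator_of_mem (zero_mem_piPrimePowBall _)] at h2
    exact one_ne_zero h2
  have key : ((lam : ℂ) * lam) • f₀ = (1 : ℂ) • f₀ := by rw [one_smul]; exact hsq
  exact smul_left_injective ℂ hf0 key

end Schur

end Literature.RepresentationTheory.MoeglinVignerasWaldspurger1987

end
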